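import Summits.Ventures.LatticeQCDFlow.Scoring.U1OpenLatticePlaquette
import HarnessLib

/-!
# Lattice Stokes and the exact area law of rectangular Wilson loops in 2-d `U(1)` with free boundary

HONEST FRAMING: exact (Metropolis-corrected) sampling algorithms for lattice gauge theory;
figures of merit are autocorrelation/cost numbers at stated couplings and volumes; no
continuum-physics claim.

Venture `LatticeQCDFlow` (cell pub-lqcd), sub-topic `Scoring`; FANOUT row 5 (`s0-sun-a`), GEN-8.
NEW WORK of the cell (placement rule).  `Scoring/U1OpenLatticePlaquette.lean` (GEN-7) proves, on the
`L₁ × L₂` grid with free boundary (incidence `openInc e`), `⟨cos(Σ_{p∈A} θ_p)⟩ = ∏_{p∈A} I₁/I₀` for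
every set `A` of plaquettes, and lists as NOT typed "the lattice Stokes identity naming `Σ_{p∈A} θ_p`
as the boundary holonomy" and "Wilson loops larger than one plaquette".  Here:

* §1 **lattice Stokes in incidence form** (any complex): `Σ_{p∈A} θ_p = Σ_l (∂A)_l θ_l` with the
  boundary 1-chain `(∂A)_l = Σ_{p∈A} inc p l` (`sum_u1PlaqAngle_eq_boundary`);
* §2 **the boundary of a rectangle** on the open grid: for the block of plaquettes
  `a₀ ≤ a < a₁`, `b₀ ≤ b < b₁` (`rect`), `∂(rect)` is the counter-clockwise perimeter loop
  `rectLoop` — `+1` on the bottom horizontal links `(a, b₀)` and the right vertical links `(a₁, b)`,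
  `−1` on the top horizontal links `(a, b₁)` and the left vertical links `(a₀, b)`, `0` elsewhere
  (`boundary_rect_eq_rectLoop`: interior links cancel in pairs);
* §3 **the exact area law**: for every `L₁, L₂ ≥ 1`, every real `β` and every rectangle,
  `⟨cos θ(∂ rect)⟩_{free, β} = (I₁(β)/I₀(β))^{(a₁−a₀)(b₁−b₀)}` (`open_u1WilsonExpect_rectLoop`) — the
  Wilson loop decays exactly with the AREA, string tension `−log(I₁(β)/I₀(β))`.

Elementary (finite sums); nothing is cited (classical: 2-d lattice gauge theory is exactly solvable,
Balian–Drouffe–Itzykson 1975, Migdal 1975).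
-/

noncomputable section

open scoped Nat
open Real MeasureTheory Set Finset Literature.Analysis.FunctionSpaces

namespace Summit.Ventures.LatticeQCDFlow.Scoring

/-! ### 1. Lattice Stokes in incidence form -/

section Stokes

variable {n : ℕ} {ι : Type*} (inc : ι → Fin (n + 1) → ℤ)

/-- The boundary 1-chain of a set of plaquettes: `(∂A)_l = Σ_{p ∈ A} inc p l`. -/
def boundaryChain (A : Finset ι) (l : Fin (n + 1)) : ℤ := ∑ p ∈ A, inc p l

/-- **Lattice Stokes**: the total plaquette angle of `A` is the angle of its boundary chain,
`Σ_{p∈A} θ_p = Σ_l (∂A)_l θ_l`. -/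
theorem sum_u1PlaqAngle_eq_boundary (A : Finset ι) (θ : Fin (n + 1) → ℝ) :
    ∑ p ∈ A, u1PlaqAngle inc p θ = ∑ l, (boundaryChain inc A l : ℝ) * θ l := by
  simp only [u1PlaqAngle, boundaryChain, Int.cast_sum, Finset.sum_mul]
  rw [Finset.sum_comm]

end Stokes

/-! ### 2. The boundary of a rectangle on the open grid -/

section OpenGrid

variable {L₁ L₂ : ℕ} {n : ℕ}
  (e : (Fin L₁ × Fin (L₂ + 1)) ⊕ (Fin (L₁ + 1) × Fin L₂) ≃ Fin (n + 1))
  (a₀ a₁ b₀ b₁ : ℕ)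

/-- The rectangle of plaquettes `a₀ ≤ a < a₁`, `b₀ ≤ b < b₁` (intersected with the grid). -/
def rect : Finset (Fin L₁ × Fin L₂) :=
  univ.filter fun x => a₀ ≤ x.1.val ∧ x.1.val < a₁ ∧ b₀ ≤ x.2.val ∧ x.2.val < b₁

/-- The counter-clockwise perimeter loop of the rectangle as a 1-chain on the links of the open grid:
`+1` on the bottom links `(a, b₀)` and right links `(a₁, b)`, `−1` on the top links `(a, b₁)` and
left links `(a₀, b)` (`a₀ ≤ a < a₁`, `b₀ ≤ b < b₁`). -/
def rectLoop (l : Fin (n + 1)) : ℤ :=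
  match e.symm l with
  | Sum.inl y => if a₀ ≤ y.1.val ∧ y.1.val < a₁ then
      (if y.2.val = b₀ then 1 else 0) - (if y.2.val = b₁ then 1 else 0) else 0
  | Sum.inr y => if b₀ ≤ y.2.val ∧ y.2.val < b₁ then
      (if y.1.val = a₁ then 1 else 0) - (if y.1.val = a₀ then 1 else 0) else 0

variable {a₀ a₁ b₀ b₁}

/-- Counting lemma: in `Fin N`, the indicator sum of `j = b.val + s` over `b₀ ≤ b < b₁` (`b₁ ≤ N`)
is the indicator of `b₀ + s ≤ j < b₁ + s`. -/
theorem sum_ite_val_add_eq {N b₀ b₁ : ℕ} (hb : b₁ ≤ N) (s j : ℕ) :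
    (∑ b ∈ (univ : Finset (Fin N)).filter (fun b => b₀ ≤ b.val ∧ b.val < b₁),
        (if j = b.val + s then (1 : ℤ) else 0)) =
      if b₀ + s ≤ j ∧ j < b₁ + s then 1 else 0 := by
  by_cases hj : b₀ + s ≤ j ∧ j < b₁ + s
  · rw [if_pos hj]
    have hjN : j - s < N := by omega
    set bs : Fin N := ⟨j - s, hjN⟩ with hbs
    have hmem : bs ∈ (univ : Finset (Fin N)).filter (fun b => b₀ ≤ b.val ∧ b.val < b₁) := by
      simp only [Finset.mem_filter, Finset.mem_univ, true_and, hbs]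
      omega
    calc (∑ b ∈ (univ : Finset (Fin N)).filter (fun b => b₀ ≤ b.val ∧ b.val < b₁),
          (if j = b.val + s then (1 : ℤ) else 0))
        = ∑ b ∈ (univ : Finset (Fin N)).filter (fun b => b₀ ≤ b.val ∧ b.val < b₁),
            (if bs = b then (1 : ℤ) else 0) := by
          refine Finset.sum_congr rfl fun b _ => ?_
          by_cases h : j = b.val + s
          · have hbb : bs = b := Fin.ext (by show j - s = b.val; omega)
            rw [if_pos h, if_pos hbb]
          · have hbb : bs ≠ b := fun h' => h (by
              have : bs.val = b.val := by rw [h']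
              simp only [hbs] at this
              omega)
            rw [if_neg h, if_neg hbb]
      _ = if bs ∈ (univ : Finset (Fin N)).filter (fun b => b₀ ≤ b.val ∧ b.val < b₁) then 1 else 0 :=
          Finset.sum_ite_eq _ bs fun _ => (1 : ℤ)
      _ = 1 := if_pos hmem
  · rw [if_neg hj]
    refine Finset.sum_eq_zero fun b hb' => ?_
    rw [Finset.mem_filter] at hb'
    rw [if_neg]
    omega

/-- The rectangle is the product of its column range and its row range. -/
theorem rect_eq_product :
    rect a₀ a₁ b₀ b₁ = ((univ : Finset (Fin L₁)).filter fun a => a₀ ≤ a.val ∧ a.val < a₁) ×ˢ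
      ((univ : Finset (Fin L₂)).filter fun b => b₀ ≤ b.val ∧ b.val < b₁) := by
  ext x
  simp only [rect, Finset.mem_filter, Finset.mem_univ, true_and, Finset.mem_product]
  tauto

/-- The number of integers of `Fin N` in `[c₀, c₁)` is `c₁ − c₀` when `c₁ ≤ N`. -/
theorem card_filter_val_Ico {N c₀ c₁ : ℕ} (hc : c₁ ≤ N) :
    ((univ : Finset (Fin N)).filter fun a => c₀ ≤ a.val ∧ a.val < c₁).card = c₁ - c₀ := by
  rw [← Finset.card_map Fin.valEmbedding, ← Nat.card_Ico c₀ c₁]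
  congr 1
  ext m
  simp only [Finset.mem_map, Finset.mem_filter, Finset.mem_univ, true_and, Fin.valEmbedding_apply,
    Finset.mem_Ico]
  constructor
  · rintro ⟨a, ⟨h1, h2⟩, rfl⟩; exact ⟨h1, h2⟩
  · rintro ⟨h1, h2⟩; exact ⟨⟨m, by omega⟩, ⟨h1, h2⟩, rfl⟩

/-- The rectangle has `(a₁ − a₀)(b₁ − b₀)` plaquettes (`a₁ ≤ L₁`, `b₁ ≤ L₂`). -/
theorem card_rect (ha : a₁ ≤ L₁) (hb : b₁ ≤ L₂) :
    (rect a₀ a₁ b₀ b₁ : Finset (Fin L₁ × Fin L₂)).card = (a₁ - a₀) * (b₁ - b₀) := by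
  rw [rect_eq_product, Finset.card_product, card_filter_val_Ico ha, card_filter_val_Ico hb]

/-- `[c₀ ≤ j < c₁] − [c₀ + 1 ≤ j < c₁ + 1] = [j = c₀] − [j = c₁]` for `c₀ ≤ c₁`. -/
theorem ite_Ico_sub_ite_Ico {c₀ c₁ : ℕ} (h : c₀ ≤ c₁) (j : ℕ) :
    ((if c₀ + 0 ≤ j ∧ j < c₁ + 0 then (1 : ℤ) else 0) - (if c₀ + 1 ≤ j ∧ j < c₁ + 1 then 1 else 0)) =
      (if j = c₀ then 1 else 0) - (if j = c₁ then 1 else 0) := by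
  split_ifs <;> omega

/-- **Lattice Stokes for a rectangle on the open grid**: the boundary chain of the block of
plaquettes `a₀ ≤ a < a₁`, `b₀ ≤ b < b₁` (`a₀ ≤ a₁ ≤ L₁`, `b₀ ≤ b₁ ≤ L₂`) is its counter-clockwise
perimeter loop — every interior link is traversed once in each direction. -/
theorem boundary_rect_eq_rectLoop (ha : a₁ ≤ L₁) (hb : b₁ ≤ L₂) (hab : a₀ ≤ a₁) (hbb : b₀ ≤ b₁)
    (l : Fin (n + 1)) :
    boundaryChain (openInc e) (rect a₀ a₁ b₀ b₁) l = rectLoop e a₀ a₁ b₀ b₁ l := by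
  unfold boundaryChain rectLoop openInc
  generalize e.symm l = y
  rcases y with y | y
  · -- horizontal link `y = (a, j)`
    obtain ⟨a, j⟩ := y
    simp only
    rw [rect_eq_product, Finset.sum_product]
    have hinner : ∀ a' : Fin L₁,
        (∑ b' ∈ (univ : Finset (Fin L₂)).filter (fun b => b₀ ≤ b.val ∧ b.val < b₁),
          ((if (a, j) = ((a', b').1, (a', b').2.castSucc) then (1 : ℤ) else 0) -
            (if (a, j) = ((a', b').1, (a', b').2.succ) then 1 else 0))) =
        if a = a' then (if j.val = b₀ then 1 else 0) - (if j.val = b₁ then 1 else 0) else 0 := by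
      intro a'
      by_cases haa : a = a'
      · subst haa
        rw [if_pos rfl, Finset.sum_sub_distrib]
        have h1 : ∀ b' : Fin L₂, ((a, j) = ((a, b').1, (a, b').2.castSucc)) ↔ j.val = b'.val + 0 := by
          intro b'; simp [Prod.ext_iff, Fin.ext_iff]
        have h2 : ∀ b' : Fin L₂, ((a, j) = ((a, b').1, (a, b').2.succ)) ↔ j.val = b'.val + 1 := by
          intro b'; simp [Prod.ext_iff, Fin.ext_iff, Fin.val_succ]
        simp_rw [h1, h2]
        rw [sum_ite_val_add_eq hb 0 j.val, sum_ite_val_add_eq hb 1 j.val, ite_Ico_sub_ite_Ico hbb]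
      · rw [if_neg haa]
        refine Finset.sum_eq_zero fun b' _ => ?_
        have h1 : ¬ (a, j) = ((a', b').1, (a', b').2.castSucc) := fun h => haa (congrArg Prod.fst h)
        have h2 : ¬ (a, j) = ((a', b').1, (a', b').2.succ) := fun h => haa (congrArg Prod.fst h)
        rw [if_neg h1, if_neg h2, sub_zero]
    simp_rw [hinner]
    rw [Finset.sum_ite_eq]
    simp only [Finset.mem_filter, Finset.mem_univ, true_and]
  · -- vertical link `y = (i, b)`
    obtain ⟨i, b⟩ := y
    simp only
    rw [rect_eq_product, Finset.sum_product_right]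
    have hinner : ∀ b' : Fin L₂,
        (∑ a' ∈ (univ : Finset (Fin L₁)).filter (fun a => a₀ ≤ a.val ∧ a.val < a₁),
          ((if (i, b) = ((a', b').1.succ, (a', b').2) then (1 : ℤ) else 0) -
            (if (i, b) = ((a', b').1.castSucc, (a', b').2) then 1 else 0))) =
        if b = b' then (if i.val = a₁ then 1 else 0) - (if i.val = a₀ then 1 else 0) else 0 := by
      intro b'
      by_cases hbb' : b = b'
      · subst hbb'
        rw [if_pos rfl, Finset.sum_sub_distrib]
        have h1 : ∀ a' : Fin L₁, ((i, b) = ((a', b).1.succ, (a', b).2)) ↔ i.val = a'.val + 1 := by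
          intro a'; simp [Prod.ext_iff, Fin.ext_iff, Fin.val_succ]
        have h2 : ∀ a' : Fin L₁, ((i, b) = ((a', b).1.castSucc, (a', b).2)) ↔ i.val = a'.val + 0 := by
          intro a'; simp [Prod.ext_iff, Fin.ext_iff]
        simp_rw [h1, h2]
        rw [sum_ite_val_add_eq ha 1 i.val, sum_ite_val_add_eq ha 0 i.val]
        have := ite_Ico_sub_ite_Ico hab i.val
        linarith
      · rw [if_neg hbb']
        refine Finset.sum_eq_zero fun a' _ => ?_
        have h1 : ¬ (i, b) = ((a', b').1.succ, (a', b').2) := fun h => hbb' (congrArg Prod.snd h)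
        have h2 : ¬ (i, b) = ((a', b').1.castSucc, (a', b').2) := fun h => hbb' (congrArg Prod.snd h)
        rw [if_neg h1, if_neg h2, sub_zero]
    simp_rw [hinner]
    rw [Finset.sum_ite_eq]
    simp only [Finset.mem_filter, Finset.mem_univ, true_and]

/-! ### 3. The exact area law -/

/-- **THE EXACT AREA LAW OF 2-d `U(1)` WITH FREE BOUNDARY.**  For every `L₁, L₂ ≥ 1`, every real `β`
and every rectangle `a₀ ≤ a < a₁ ≤ L₁`, `b₀ ≤ b < b₁ ≤ L₂`, the Wilson loop around its perimeter has
expectation `⟨cos θ(∂R)⟩ = (I₁(β)/I₀(β))^{(a₁−a₀)(b₁−b₀)}` — exact exponential decay with the AREA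
(string tension `−log(I₁(β)/I₀(β))`). -/
theorem open_u1WilsonExpect_rectLoop (ha : a₁ ≤ L₁) (hb : b₁ ≤ L₂) (hab : a₀ ≤ a₁) (hbb : b₀ ≤ b₁)
    (β : ℝ) :
    u1WilsonExpect univ (openInc e) (fun _ => β)
        (fun θ => Real.cos (∑ l, (rectLoop e a₀ a₁ b₀ b₁ l : ℝ) * θ l)) =
      (besselI 1 β / besselI 0 β) ^ ((a₁ - a₀) * (b₁ - b₀)) := by
  have hfun : (fun θ : Fin (n + 1) → ℝ => Real.cos (∑ l, (rectLoop e a₀ a₁ b₀ b₁ l : ℝ) * θ l)) =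
      fun θ => Real.cos (∑ p ∈ rect a₀ a₁ b₀ b₁, u1PlaqAngle (openInc e) p θ) := by
    funext θ
    rw [sum_u1PlaqAngle_eq_boundary]
    simp_rw [boundary_rect_eq_rectLoop e ha hb hab hbb]
  rw [hfun, u1WilsonExpect_cos_region_of_free _ _ (openInc_free e), Finset.prod_const,
    card_rect ha hb]

/-- With per-plaquette couplings the same Wilson loop factorises over the enclosed plaquettes:
`⟨cos θ(∂R)⟩ = ∏_{p ∈ R} I₁(β_p)/I₀(β_p)`. -/
theorem open_u1WilsonExpect_rectLoop_prod (ha : a₁ ≤ L₁) (hb : b₁ ≤ L₂) (hab : a₀ ≤ a₁)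
    (hbb : b₀ ≤ b₁) (βp : Fin L₁ × Fin L₂ → ℝ) :
    u1WilsonExpect univ (openInc e) βp
        (fun θ => Real.cos (∑ l, (rectLoop e a₀ a₁ b₀ b₁ l : ℝ) * θ l)) =
      ∏ p ∈ rect a₀ a₁ b₀ b₁, besselI 1 (βp p) / besselI 0 (βp p) := by
  have hfun : (fun θ : Fin (n + 1) → ℝ => Real.cos (∑ l, (rectLoop e a₀ a₁ b₀ b₁ l : ℝ) * θ l)) =
      fun θ => Real.cos (∑ p ∈ rect a₀ a₁ b₀ b₁, u1PlaqAngle (openInc e) p θ) := by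
    funext θ
    rw [sum_u1PlaqAngle_eq_boundary]
    simp_rw [boundary_rect_eq_rectLoop e ha hb hab hbb]
  rw [hfun, u1WilsonExpect_cos_region_of_free _ _ (openInc_free e)]

end OpenGrid

end Summit.Ventures.LatticeQCDFlow.Scoring
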